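import Summits.QuantumFields.YangMills.Theorems.FluctuationComparisonRegPrIntLS2BetaWhitneyHatLiftRelativeSup
import Literature.Analysis.Calculus.ExpDuhamel
import HarnessLib

/-!
# S2β · THE SUP CHAIN, NC-ROW′ ∕ (SCT′₂), THE `V`-ROW IN CHORD CURRENCY — the TWO-FACTOR BCH BOUND `‖e^{X+Y} − e^X e^Y‖ ≤ 2(e^{‖X‖}−1)(e^{‖Y‖}−1)` (any complete
# normed ℝ-algebra), its `SU(2)` chord form `dist1 ((e^a)⁻¹·e^{a+d}·(e^d)⁻¹) ≤ 2(e^{‖a‖}−1)(e^{‖d‖}−1) ≤ 8‖a‖‖d‖`, and the RELATIVE-LIFT PAIR LETTER the `V`-row consumes: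
# `dist1 (R⟨z+e_ι,κ⟩·R⟨z,κ⟩⁻¹) ≤ (L⁻¹)²·v + 16·(L⁻¹σ)·(L⁻¹r)` for the hat lifts' relative chord `R := V⁻¹·V′` (px21 g24 §102.9, «chord currency» 19:24:28Z)

Cell `ym3-torus` (YM ladder rung R3 = continuum `SU(2)` Yang–Mills on the three-torus at fixed lattice data — a RUNG: NOT d = 4, NOT infinite volume, NOT a mass gap,
NOT Clay).  Width seat «width 12» `ym3-torus-px12` (gen 26), FREE px helper on crux `stmt-QuantumFields-20520`; LINE g18-1 S2β, sup chain: LIFT-LADDER″'s NC-ROW′ has a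
`V`-row (transverse variation of relative chords; holder px21 g24 ✓`…RelativeLiftFactorisation` §3: `dist1(η′η⁻¹) ≤ dist1(R′R⁻¹) + 2·dist1 R·dist1(δ′δ⁻¹) + dist1 ε′ + dist1 ε`).
`--kind proof --supports stmt-QuantumFields-20520 --as helper`, count-neutral, DEFINITION-FREE (0 `def`, 0 `instance`, 0 `notation`, 0 `sorry`, default heartbeats).

WHY.  The `V→V` coefficient of the `V`-row reads the relative LIFT's adjacent variation `dist1 (R b′·(R b)⁻¹)` in CHORD currency, while the hat lift is linear in the LOGS:
this lineage's ✓p829498 `norm_logVec_lift_rel_sub_shift_le(_of_support)` gives the exact contraction `‖(log V′−log V)(b′) − (log V′−log V)(b)‖ ≤ (L⁻¹)²·v` (constant ONE).  The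
conversion chord ↔ log-difference for the RELATIVE chord `R b = (e^{a})⁻¹e^{a+d}` (`a = log V b`, `d = log V′ b − log V b`) is a genuine two-factor Baker–Campbell–Hausdorff
remainder `(e^a)⁻¹e^{a+d}(e^d)⁻¹ ≠ 1`; its size must be MIXED (`∝ ‖a‖·‖d‖`: absolute arc × relative size — px21's `O(s·M)` column), not absolute (`12τ²`, ✓`dist1_plaq4_le`),
else the row would not be a relative letter.  The tree had no two-factor BCH bound; §1–§2 supply it.

WHAT IS PROVED (sorry-free).
§1 ANY COMPLETE NORMED ℝ-ALGEBRA ([folklore], power series of `NormedSpace.exp`): `norm_mixed_pow_le` (`‖(X+Y)ⁿ⁺¹ − Xⁿ⁺¹ − Yⁿ⁺¹‖ ≤ (x+y)ⁿ⁺¹ − xⁿ⁺¹ − yⁿ⁺¹`, the mixed words),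
   `hasSum_exp_sub_one_real`∕`hasSum_exp_sub_one` (the shifted exponential series; `‖e^X − 1‖ ≤ e^{‖X‖} − 1` is lit ✓`Literature.Analysis.Calculus.norm_exp_sub_one_le`, REUSED), ★`norm_exp_add_sub_exp_sub_exp_add_one_le`
   (`‖e^{X+Y} − e^X − e^Y + 1‖ ≤ (e^x−1)(e^y−1)`), ★★★`norm_exp_add_sub_exp_mul_exp_le` (**`‖e^{X+Y} − e^X·e^Y‖ ≤ 2(e^{‖X‖}−1)(e^{‖Y‖}−1)`**; `e^{X+Y} − e^Xe^Y = (mixed words) −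
   (e^X−1)(e^Y−1)`).
§2 `SU(2)`: ★★`dist1_inv_mul_expPoint_add_mul_inv_le` (`dist1 ((e^a)⁻¹·e^{a+d}·(e^d)⁻¹) ≤ 2(e^{‖a‖}−1)(e^{‖d‖}−1)`: unit quaternions are isometric multipliers),
   ★`…_le_eight_mul` (`≤ 8‖a‖‖d‖` for `‖a‖, ‖d‖ ≤ 1`, Mathlib `Real.abs_exp_sub_one_le`), ★`dist1_relChord_pair_le` (the two-bond telescope: for `R_i := (e^{a_i})⁻¹e^{a_i+d_i}`,
   `dist1 (R₁·R₀⁻¹) ≤ ‖d₁ − d₀‖ + 8‖a₁‖‖d₁‖ + 8‖a₀‖‖d₀‖`).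
§3 THE PAIR LETTER FOR THE HAT LIFTS (generic `Params`, levels `t`∕`t+1`, weights `hw`, lifts `hV`∕`hV′`; ✓`arc_lift_le`, ✓`norm_logVec_lift_sub_le`, ✓p829498):
   ★★★`dist1_liftRelChord_shift_mul_inv_le` — arcs of `X, X′ ≤ σ ≤ 1` and log-differences `≤ r ≤ 1` on the two supports, global coarse relative variation `≤ v`:
   **`dist1 (R⟨z+e_ι,κ⟩·(R⟨z,κ⟩)⁻¹) ≤ (L⁻¹)²·v + 16·((L⁻¹·σ)·(L⁻¹·r))`**, `R b := (V b)⁻¹·V′ b`; ★★`…_of_support` — the column-local edition over ✓p829498 `…_of_support`.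

HONEST SCOPE.  Elementary analysis (exponential series) and compositions of landed lift letters; nothing of Bałaban's renormalisation-group analysis is asserted or proved
([Balaban1985RegularSpaces] (1.29) p.81 — the printed `L⁻¹`∕`L⁻²` regularity of the lift; [Balaban1985Variational] (34) p.283 — the printed second-order plaquette expansion);
the `V`-row's remaining letters (the `Ad` price, `ε`'s sources ✓p831xxx `…Eps`, `ρ̃`, the READ′ aggregation and budget), NC-ROW′, (SCT′₂), (RSP), (ST′)∕(ST), LOC, GAP♯∘
(`stub_uniformFibreGapOrbit`, registry 3732b7df UNTOUCHED), the five registered stubs (0∕5), S2β, 20520, 19936, 19200, `YM3TorusSU2` are NOT proved; no registered stub is closed;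
rung R3 — NOT d = 4, NOT infinite volume, NOT a mass gap, NOT Clay; the Yang–Mills mass gap is NOT proved.
-/

set_option autoImplicit false

namespace Summit.QuantumFields.YangMills.Theorems.FluctuationComparisonRegPrIntLS2BetaRelativeLiftPairChord

open NormedSpace Finset
open scoped Nat Real
open Literature.MathematicalPhysics.QuantumLattice (su2Quat norm_su2Quat)
open Literature.MathematicalPhysics.QuantumFieldTheory.Balaban1983to89
open T4Continuum
open B10Eq27TorusAxialLog (rel)
open T4CubeChartGnomonic (SU2)
open T4HaarSU2ExpChart (expPoint imQuat su2Quat_expPoint norm_imQuat)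
open T4HaarSU2Translate (su2Quat_mul su2Quat_one)
open T4ExpWindowSmallField (logVec expPoint_logVec dist1_eq_norm_su2Quat_sub_one)
open Summit.QuantumFields.YangMills.Theorems.FluctuationComparisonRegPrIntLS2BetaWhitneyHatLift (arc_lift_le)
open Summit.QuantumFields.YangMills.Theorems.FluctuationComparisonRegPrIntLS2BetaWhitneyHatLiftRelative
  (norm_logVec_lift_sub_le dist1_expPoint_mul_inv_expPoint_le)
open Summit.QuantumFields.YangMills.Theorems.FluctuationComparisonRegPrIntLS2BetaWhitneyHatLiftRelativeSup
  (norm_logVec_lift_rel_sub_shift_le norm_logVec_lift_rel_sub_shift_le_of_support)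

/-! ## §1 The two-factor Baker–Campbell–Hausdorff bound in a complete normed algebra -/

section Banach

variable {𝔸 : Type*} [NormedRing 𝔸]

/-- **MIXED WORDS**: `‖(X+Y)ⁿ⁺¹ − Xⁿ⁺¹ − Yⁿ⁺¹‖ ≤ (‖X‖+‖Y‖)ⁿ⁺¹ − ‖X‖ⁿ⁺¹ − ‖Y‖ⁿ⁺¹` (induction: `M_{n+2} = (X+Y)·M_{n+1} + X·Yⁿ⁺¹ + Y·Xⁿ⁺¹`). [folklore] -/
theorem norm_mixed_pow_le (X Y : 𝔸) : ∀ n : ℕ,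
    ‖(X + Y) ^ (n + 1) - X ^ (n + 1) - Y ^ (n + 1)‖ ≤ (‖X‖ + ‖Y‖) ^ (n + 1) - ‖X‖ ^ (n + 1) - ‖Y‖ ^ (n + 1)
  | 0 => by simp
  | n + 1 => by
    have ih := norm_mixed_pow_le X Y n
    have e : (X + Y) ^ (n + 2) - X ^ (n + 2) - Y ^ (n + 2) =
        (X + Y) * ((X + Y) ^ (n + 1) - X ^ (n + 1) - Y ^ (n + 1)) + X * Y ^ (n + 1) + Y * X ^ (n + 1) := by
      simp only [pow_succ']
      noncomm_ring
    rw [e]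
    have hx := norm_nonneg X
    have hy := norm_nonneg Y
    have h1 : ‖(X + Y) * ((X + Y) ^ (n + 1) - X ^ (n + 1) - Y ^ (n + 1))‖ ≤
        (‖X‖ + ‖Y‖) * ((‖X‖ + ‖Y‖) ^ (n + 1) - ‖X‖ ^ (n + 1) - ‖Y‖ ^ (n + 1)) :=
      (norm_mul_le _ _).trans (mul_le_mul (norm_add_le _ _) ih (norm_nonneg _) (by positivity))
    have h2 : ‖X * Y ^ (n + 1)‖ ≤ ‖X‖ * ‖Y‖ ^ (n + 1) :=
      (norm_mul_le _ _).trans (mul_le_mul_of_nonneg_left (norm_pow_le' _ (Nat.succ_pos _)) hx)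
    have h3 : ‖Y * X ^ (n + 1)‖ ≤ ‖Y‖ * ‖X‖ ^ (n + 1) :=
      (norm_mul_le _ _).trans (mul_le_mul_of_nonneg_left (norm_pow_le' _ (Nat.succ_pos _)) hy)
    have h4 := (norm_add_le _ _).trans (add_le_add ((norm_add_le _ _).trans (add_le_add h1 h2)) h3)
    refine h4.trans (le_of_eq ?_)
    ring

/-- The real exponential series shifted by one: `Σ_{n} xⁿ⁺¹∕(n+1)! = e^x − 1`. [folklore] -/
theorem hasSum_exp_sub_one_real (x : ℝ) : HasSum (fun n : ℕ => ((n + 1)! : ℝ)⁻¹ * x ^ (n + 1)) (Real.exp x - 1) := by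
  have h := NormedSpace.exp_series_hasSum_exp' (𝕂 := ℝ) x
  rw [← Real.exp_eq_exp_ℝ] at h
  have h2 := (hasSum_nat_add_iff' (f := fun n : ℕ => ((n ! : ℝ)⁻¹) • x ^ n) 1).mpr h
  simpa [smul_eq_mul] using h2

variable [NormedAlgebra ℝ 𝔸] [CompleteSpace 𝔸]

/-- The exponential series of `NormedSpace.exp` shifted by one: `Σ_{n} Xⁿ⁺¹∕(n+1)! = e^X − 1`. [folklore] -/
theorem hasSum_exp_sub_one (X : 𝔸) : HasSum (fun n : ℕ => ((n + 1)! : ℝ)⁻¹ • X ^ (n + 1)) (exp X - 1) := by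
  have h := NormedSpace.exp_series_hasSum_exp' (𝕂 := ℝ) X
  have h2 := (hasSum_nat_add_iff' (f := fun n : ℕ => ((n ! : ℝ)⁻¹) • X ^ n) 1).mpr h
  simpa using h2

/-- ★ **THE MIXED PART OF THE EXPONENTIAL**: `‖e^{X+Y} − e^X − e^Y + 1‖ ≤ (e^{‖X‖} − 1)(e^{‖Y‖} − 1)` (termwise by the mixed-words bound). [folklore] -/
theorem norm_exp_add_sub_exp_sub_exp_add_one_le (X Y : 𝔸) :
    ‖exp (X + Y) - exp X - exp Y + 1‖ ≤ (Real.exp ‖X‖ - 1) * (Real.exp ‖Y‖ - 1) := by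
  have hXY := hasSum_exp_sub_one (X + Y)
  have hX := hasSum_exp_sub_one X
  have hY := hasSum_exp_sub_one Y
  have hM : HasSum (fun n : ℕ => ((n + 1)! : ℝ)⁻¹ • ((X + Y) ^ (n + 1) - X ^ (n + 1) - Y ^ (n + 1))) (exp (X + Y) - exp X - exp Y + 1) := by
    have h := (hXY.sub hX).sub hY
    have e : exp (X + Y) - 1 - (exp X - 1) - (exp Y - 1) = exp (X + Y) - exp X - exp Y + 1 := by abel
    rw [e] at h
    simpa only [smul_sub] using h
  have hx := hasSum_exp_sub_one_real ‖X‖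
  have hy := hasSum_exp_sub_one_real ‖Y‖
  have hxy := hasSum_exp_sub_one_real (‖X‖ + ‖Y‖)
  have hm : HasSum (fun n : ℕ => ((n + 1)! : ℝ)⁻¹ * ((‖X‖ + ‖Y‖) ^ (n + 1) - ‖X‖ ^ (n + 1) - ‖Y‖ ^ (n + 1)))
      ((Real.exp (‖X‖ + ‖Y‖) - 1) - (Real.exp ‖X‖ - 1) - (Real.exp ‖Y‖ - 1)) := by
    have h := (hxy.sub hx).sub hy
    simpa only [mul_sub] using h
  have hb := HasSum.norm_le_of_bounded hM hm fun n => by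
    rw [norm_smul, Real.norm_eq_abs, abs_of_nonneg (by positivity)]
    exact mul_le_mul_of_nonneg_left (norm_mixed_pow_le X Y n) (by positivity)
  refine hb.trans (le_of_eq ?_)
  rw [Real.exp_add]; ring

/-- ★★★ **THE TWO-FACTOR BAKER–CAMPBELL–HAUSDORFF BOUND**: `‖e^{X+Y} − e^X·e^Y‖ ≤ 2·(e^{‖X‖} − 1)·(e^{‖Y‖} − 1)` in any complete normed ℝ-algebra
(`e^{X+Y} − e^Xe^Y = (e^{X+Y} − e^X − e^Y + 1) − (e^X − 1)(e^Y − 1)`). [folklore] -/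
theorem norm_exp_add_sub_exp_mul_exp_le (X Y : 𝔸) :
    ‖exp (X + Y) - exp X * exp Y‖ ≤ 2 * ((Real.exp ‖X‖ - 1) * (Real.exp ‖Y‖ - 1)) := by
  have e : exp (X + Y) - exp X * exp Y = (exp (X + Y) - exp X - exp Y + 1) - (exp X - 1) * (exp Y - 1) := by noncomm_ring
  rw [e]
  refine (norm_sub_le _ _).trans ?_
  have h1 := norm_exp_add_sub_exp_sub_exp_add_one_le X Y
  have h2 : ‖(exp X - 1) * (exp Y - 1)‖ ≤ (Real.exp ‖X‖ - 1) * (Real.exp ‖Y‖ - 1) :=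
    (norm_mul_le _ _).trans (mul_le_mul (Literature.Analysis.Calculus.norm_exp_sub_one_le X) (Literature.Analysis.Calculus.norm_exp_sub_one_le Y) (norm_nonneg _)
      (by have := Real.add_one_le_exp ‖X‖; linarith [norm_nonneg X]))
  linarith

end Banach

/-! ## §2 The `SU(2)` chord form: the two-factor BCH defect of a relative chord -/

section SU2

/-- ★★ **THE BCH DEFECT OF A RELATIVE CHORD, IN `dist1`**: `dist1 ((e^a)⁻¹·e^{a+d}·(e^d)⁻¹) ≤ 2(e^{‖a‖} − 1)(e^{‖d‖} − 1)` on `SU(2)` (unit quaternions multiply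
isometrically; §1 at `X := ι a`, `Y := ι d`). [folklore] -/
theorem dist1_inv_mul_expPoint_add_mul_inv_le (a d : EuclideanSpace ℝ (Fin 3)) :
    dist1 ((expPoint a)⁻¹ * expPoint (a + d) * (expPoint d)⁻¹) ≤ 2 * ((Real.exp ‖a‖ - 1) * (Real.exp ‖d‖ - 1)) := by
  rw [dist1_eq_norm_su2Quat_sub_one, su2Quat_mul, su2Quat_mul, su2Quat_expPoint]
  set p := su2Quat (expPoint a)⁻¹ with hp
  set q := su2Quat (expPoint d)⁻¹ with hq
  have hpa : p * exp (imQuat a) = 1 := by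
    rw [hp, ← su2Quat_expPoint, ← su2Quat_mul, inv_mul_cancel, su2Quat_one]
  have hdq : exp (imQuat d) * q = 1 := by
    rw [hq, ← su2Quat_expPoint, ← su2Quat_mul, mul_inv_cancel, su2Quat_one]
  have e : p * exp (imQuat (a + d)) * q - 1 = p * (exp (imQuat (a + d)) - exp (imQuat a) * exp (imQuat d)) * q := by
    have h1 : p * (exp (imQuat a) * exp (imQuat d)) * q = 1 := by
      rw [← mul_assoc, hpa, one_mul, hdq]
    rw [mul_sub, sub_mul, h1]
  rw [e]
  have hB := norm_exp_add_sub_exp_mul_exp_le (imQuat a) (imQuat d)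
  rw [← map_add, norm_imQuat, norm_imQuat] at hB
  calc ‖p * (exp (imQuat (a + d)) - exp (imQuat a) * exp (imQuat d)) * q‖
      ≤ ‖p‖ * ‖exp (imQuat (a + d)) - exp (imQuat a) * exp (imQuat d)‖ * ‖q‖ :=
        (norm_mul_le _ _).trans (mul_le_mul_of_nonneg_right (norm_mul_le _ _) (norm_nonneg _))
    _ ≤ 1 * (2 * ((Real.exp ‖a‖ - 1) * (Real.exp ‖d‖ - 1))) * 1 := by
        rw [hp, hq, norm_su2Quat, norm_su2Quat]
        exact mul_le_mul_of_nonneg_right (mul_le_mul_of_nonneg_left hB zero_le_one) zero_le_one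
    _ = 2 * ((Real.exp ‖a‖ - 1) * (Real.exp ‖d‖ - 1)) := by ring

/-- ★ **THE SAME, LINEAR CONSTANTS**: for `‖a‖, ‖d‖ ≤ 1`, `dist1 ((e^a)⁻¹·e^{a+d}·(e^d)⁻¹) ≤ 8·‖a‖·‖d‖` (Mathlib `Real.abs_exp_sub_one_le`: `e^x − 1 ≤ 2x` on `[0,1]`) —
the MIXED size the `V`-row's `O(s·M)` column budgets. [folklore] -/
theorem dist1_inv_mul_expPoint_add_mul_inv_le_eight_mul (a d : EuclideanSpace ℝ (Fin 3)) (ha : ‖a‖ ≤ 1) (hd : ‖d‖ ≤ 1) :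
    dist1 ((expPoint a)⁻¹ * expPoint (a + d) * (expPoint d)⁻¹) ≤ 8 * (‖a‖ * ‖d‖) := by
  have h := dist1_inv_mul_expPoint_add_mul_inv_le a d
  have h1 : Real.exp ‖a‖ - 1 ≤ 2 * ‖a‖ := by
    have := Real.abs_exp_sub_one_le (x := ‖a‖) (by rw [abs_of_nonneg (norm_nonneg _)]; exact ha)
    rw [abs_of_nonneg (norm_nonneg a)] at this
    exact (le_abs_self _).trans this
  have h2 : Real.exp ‖d‖ - 1 ≤ 2 * ‖d‖ := by
    have := Real.abs_exp_sub_one_le (x := ‖d‖) (by rw [abs_of_nonneg (norm_nonneg _)]; exact hd)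
    rw [abs_of_nonneg (norm_nonneg d)] at this
    exact (le_abs_self _).trans this
  have h0a : 0 ≤ Real.exp ‖a‖ - 1 := by have := Real.add_one_le_exp ‖a‖; linarith [norm_nonneg a]
  have h0d : 0 ≤ Real.exp ‖d‖ - 1 := by have := Real.add_one_le_exp ‖d‖; linarith [norm_nonneg d]
  nlinarith [mul_le_mul h1 h2 h0d (by positivity : (0 : ℝ) ≤ 2 * ‖a‖)]

/-- **THE TWO-BOND TELESCOPE, ABSTRACTLY** (any `GaugeGroup`): `(x₁⁻¹y₁)·(x₀⁻¹y₀)⁻¹ = Q₁·(e₁e₀⁻¹)·Q₀⁻¹` with `Q_i := x_i⁻¹·y_i·e_i⁻¹`, hence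
`dist1 ((x₁⁻¹y₁)(x₀⁻¹y₀)⁻¹) ≤ dist1 Q₁ + dist1 (e₁e₀⁻¹) + dist1 Q₀`. [folklore] -/
theorem dist1_rel_pair_telescope {G : Type*} [GaugeGroup G] (x₁ y₁ e₁ x₀ y₀ e₀ : G) :
    dist1 ((x₁⁻¹ * y₁) * (x₀⁻¹ * y₀)⁻¹) ≤ dist1 (x₁⁻¹ * y₁ * e₁⁻¹) + dist1 (e₁ * e₀⁻¹) + dist1 (x₀⁻¹ * y₀ * e₀⁻¹) := by
  have e : (x₁⁻¹ * y₁) * (x₀⁻¹ * y₀)⁻¹ = (x₁⁻¹ * y₁ * e₁⁻¹) * (e₁ * e₀⁻¹) * (x₀⁻¹ * y₀ * e₀⁻¹)⁻¹ := by group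
  rw [e]
  calc dist1 ((x₁⁻¹ * y₁ * e₁⁻¹) * (e₁ * e₀⁻¹) * (x₀⁻¹ * y₀ * e₀⁻¹)⁻¹)
      ≤ dist1 ((x₁⁻¹ * y₁ * e₁⁻¹) * (e₁ * e₀⁻¹)) + dist1 (x₀⁻¹ * y₀ * e₀⁻¹)⁻¹ := GaugeGroup.dist1_mul_le _ _
    _ ≤ dist1 (x₁⁻¹ * y₁ * e₁⁻¹) + dist1 (e₁ * e₀⁻¹) + dist1 (x₀⁻¹ * y₀ * e₀⁻¹) := by
        rw [GaugeGroup.dist1_inv]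
        have h := GaugeGroup.dist1_mul_le (x₁⁻¹ * y₁ * e₁⁻¹) (e₁ * e₀⁻¹)
        linarith

/-- ★ **THE TWO-BOND TELESCOPE FOR RELATIVE CHORDS**: with `R_i := (e^{a_i})⁻¹·e^{a_i + d_i}` (`i = 0, 1`) and `‖a_i‖, ‖d_i‖ ≤ 1`,
`dist1 (R₁·R₀⁻¹) ≤ ‖d₁ − d₀‖ + 8‖a₁‖‖d₁‖ + 8‖a₀‖‖d₀‖` (`R_i = Q_i·e^{d_i}` with `Q_i` the BCH defect; the middle factor `e^{d₁}(e^{d₀})⁻¹` is `≤ ‖d₁ − d₀‖`,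
✓`dist1_expPoint_mul_inv_expPoint_le`). [folklore] -/
theorem dist1_relChord_pair_le (a₀ d₀ a₁ d₁ : EuclideanSpace ℝ (Fin 3)) (ha₀ : ‖a₀‖ ≤ 1) (hd₀ : ‖d₀‖ ≤ 1) (ha₁ : ‖a₁‖ ≤ 1) (hd₁ : ‖d₁‖ ≤ 1) :
    dist1 (((expPoint a₁)⁻¹ * expPoint (a₁ + d₁)) * ((expPoint a₀)⁻¹ * expPoint (a₀ + d₀))⁻¹) ≤
      ‖d₁ - d₀‖ + 8 * (‖a₁‖ * ‖d₁‖) + 8 * (‖a₀‖ * ‖d₀‖) := by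
  have h := dist1_rel_pair_telescope (expPoint a₁) (expPoint (a₁ + d₁)) (expPoint d₁) (expPoint a₀) (expPoint (a₀ + d₀)) (expPoint d₀)
  have h1 := dist1_inv_mul_expPoint_add_mul_inv_le_eight_mul a₁ d₁ ha₁ hd₁
  have h0 := dist1_inv_mul_expPoint_add_mul_inv_le_eight_mul a₀ d₀ ha₀ hd₀
  have hm : dist1 (expPoint d₁ * (expPoint d₀)⁻¹) ≤ ‖d₁ - d₀‖ := dist1_expPoint_mul_inv_expPoint_le d₁ d₀
  linarith

end SU2

/-! ## §3 The pair letter for the hat lifts' relative chord -/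

section Lift

variable {P : Params} {t : ℕ}

/-- ★★★ **THE RELATIVE-LIFT PAIR LETTER IN CHORD CURRENCY** (the `V→V` entry of px21 g24's `V`-row): hat weights `w` (`hw`), coarse fields `X, X′` at level `t+1` with
lifts `V, V′` at level `t` (`hV`, `hV′`); if on the two supports the coarse arcs are `≤ σ ≤ 1` and the coarse log-differences `‖log X e − log X′ e‖ ≤ r ≤ 1`, and the coarse
relative variation is `≤ v` (adjacent transverse differences of `log X − log X′`, direction `ι ≠ κ`), then for the relative chord `R b := (V b)⁻¹·V′ b`:
`dist1 (R⟨z+e_ι,κ⟩·(R⟨z,κ⟩)⁻¹) ≤ (L⁻¹)²·v + 16·((L⁻¹·σ)·(L⁻¹·r))` — the lift's exact `L⁻²` contraction (✓p829498) plus the two BCH defects (§2), each `≤ 8·(L⁻¹σ)(L⁻¹r)`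
(✓`arc_lift_le`, ✓`norm_logVec_lift_sub_le`). [cite: Balaban1985RegularSpaces, (1.29) p.81] -/
theorem dist1_liftRelChord_shift_mul_inv_le (ht : t + 1 ≤ P.m + P.K) (w : PBond P t → PBond P (t + 1) → ℝ)
    (hw : ∀ b e, w b e = if e.dir = b.dir ∧ (b.src b.dir - emb e.src b.dir).val < P.L then
      ∏ ν ∈ Finset.univ.erase b.dir, max 0 (1 - ((rel (emb e.src) b.src ν).natAbs : ℝ) / P.L) else 0)
    (X X' : GaugeField P (t + 1) SU2) (V V' : GaugeField P t SU2)
    (hV : ∀ b, V b = expPoint (∑ e, w b e • ((P.L : ℝ)⁻¹ • logVec (su2Quat (X e)))))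
    (hV' : ∀ b, V' b = expPoint (∑ e, w b e • ((P.L : ℝ)⁻¹ • logVec (su2Quat (X' e)))))
    (z : Site P t) {ι κ : Fin P.d} (hικ : ι ≠ κ) {σ r v : ℝ} (hσ1 : σ ≤ 1) (hr1 : r ≤ 1)
    (hσ : ∀ e, (w ⟨z, κ⟩ e ≠ 0 ∨ w ⟨z.shift ι, κ⟩ e ≠ 0) → ‖logVec (su2Quat (X e))‖ ≤ σ)
    (hr : ∀ e, (w ⟨z, κ⟩ e ≠ 0 ∨ w ⟨z.shift ι, κ⟩ e ≠ 0) → ‖logVec (su2Quat (X e)) - logVec (su2Quat (X' e))‖ ≤ r)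
    (hv : ∀ (y : Site P (t + 1)) (ι' κ' : Fin P.d), ι' ≠ κ' →
      ‖(logVec (su2Quat (X ⟨y.shift ι', κ'⟩)) - logVec (su2Quat (X' ⟨y.shift ι', κ'⟩)))
        - (logVec (su2Quat (X ⟨y, κ'⟩)) - logVec (su2Quat (X' ⟨y, κ'⟩)))‖ ≤ v) :
    dist1 (((V ⟨z.shift ι, κ⟩)⁻¹ * V' ⟨z.shift ι, κ⟩) * ((V ⟨z, κ⟩)⁻¹ * V' ⟨z, κ⟩)⁻¹) ≤
      ((P.L : ℝ)⁻¹) ^ 2 * v + 16 * (((P.L : ℝ)⁻¹ * σ) * ((P.L : ℝ)⁻¹ * r)) := by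
  have hL0 : 0 ≤ (P.L : ℝ)⁻¹ := inv_nonneg.mpr (Nat.cast_nonneg _)
  have hL1 : (P.L : ℝ)⁻¹ ≤ 1 := by
    have hL : (1 : ℝ) ≤ (P.L : ℝ) := by exact_mod_cast P.hL.2.le
    exact inv_le_one_of_one_le₀ hL
  -- the logs of the lifts: `a_i := log V b_i`, `a_i + d_i := log V′ b_i`
  set b₀ : PBond P t := ⟨z, κ⟩ with hb₀
  set b₁ : PBond P t := ⟨z.shift ι, κ⟩ with hb₁
  set a₀ := logVec (su2Quat (V b₀)) with ha₀
  set a₁ := logVec (su2Quat (V b₁)) with ha₁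
  set d₀ := logVec (su2Quat (V' b₀)) - logVec (su2Quat (V b₀)) with hd₀
  set d₁ := logVec (su2Quat (V' b₁)) - logVec (su2Quat (V b₁)) with hd₁
  -- sizes: arcs of the lifts `≤ L⁻¹σ`, log-differences `≤ L⁻¹r`
  have hσ0 : ∀ e, w b₀ e ≠ 0 → ‖logVec (su2Quat (X e))‖ ≤ σ := fun e he => hσ e (Or.inl he)
  have hσ1' : ∀ e, w b₁ e ≠ 0 → ‖logVec (su2Quat (X e))‖ ≤ σ := fun e he => hσ e (Or.inr he)
  have hr0 : ∀ e, w b₀ e ≠ 0 → ‖logVec (su2Quat (X e)) - logVec (su2Quat (X' e))‖ ≤ r := fun e he => hr e (Or.inl he)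
  have hr1' : ∀ e, w b₁ e ≠ 0 → ‖logVec (su2Quat (X e)) - logVec (su2Quat (X' e))‖ ≤ r := fun e he => hr e (Or.inr he)
  have hA₀ : ‖a₀‖ ≤ (P.L : ℝ)⁻¹ * σ := arc_lift_le ht w hw X V hV b₀ hσ0
  have hA₁ : ‖a₁‖ ≤ (P.L : ℝ)⁻¹ * σ := arc_lift_le ht w hw X V hV b₁ hσ1'
  have hD₀ : ‖d₀‖ ≤ (P.L : ℝ)⁻¹ * r := by
    rw [hd₀, norm_sub_rev]; exact norm_logVec_lift_sub_le ht w hw X X' V V' hV hV' b₀ hr0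
  have hD₁ : ‖d₁‖ ≤ (P.L : ℝ)⁻¹ * r := by
    rw [hd₁, norm_sub_rev]; exact norm_logVec_lift_sub_le ht w hw X X' V V' hV hV' b₁ hr1'
  -- signs and unit bounds
  have hLpos : 0 < (P.L : ℝ)⁻¹ := by
    have h2 : (0 : ℝ) < (P.L : ℝ) := by exact_mod_cast lt_trans zero_lt_one P.hL.2
    exact inv_pos.mpr h2
  have hσ0' : 0 ≤ σ := (mul_nonneg_iff_of_pos_left hLpos).mp ((norm_nonneg _).trans hA₀)
  have hr0'' : 0 ≤ r := (mul_nonneg_iff_of_pos_left hLpos).mp ((norm_nonneg _).trans hD₀)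
  have hLσ1 : (P.L : ℝ)⁻¹ * σ ≤ 1 := (mul_le_of_le_one_left hσ0' hL1).trans hσ1
  have hLr1 : (P.L : ℝ)⁻¹ * r ≤ 1 := (mul_le_of_le_one_left hr0'' hL1).trans hr1
  -- the four bond values through their logs
  have eV₀ : V b₀ = expPoint a₀ := (expPoint_logVec (V b₀)).symm
  have eV₁ : V b₁ = expPoint a₁ := (expPoint_logVec (V b₁)).symm
  have eV₀' : V' b₀ = expPoint (a₀ + d₀) := by
    rw [ha₀, hd₀, add_sub_cancel]; exact (expPoint_logVec (V' b₀)).symm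
  have eV₁' : V' b₁ = expPoint (a₁ + d₁) := by
    rw [ha₁, hd₁, add_sub_cancel]; exact (expPoint_logVec (V' b₁)).symm
  have key := dist1_relChord_pair_le a₀ d₀ a₁ d₁ (hA₀.trans hLσ1) (hD₀.trans hLr1) (hA₁.trans hLσ1) (hD₁.trans hLr1)
  rw [← eV₀, ← eV₁, ← eV₀', ← eV₁'] at key
  -- the main term: the lift's exact `L⁻²` contraction of the log-difference field
  have hmain : ‖d₁ - d₀‖ ≤ ((P.L : ℝ)⁻¹) ^ 2 * v := by
    have h := norm_logVec_lift_rel_sub_shift_le ht w hw X X' V V' hV hV' hv z hικ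
    have e3 : d₁ - d₀ = -((logVec (su2Quat (V b₁)) - logVec (su2Quat (V' b₁))) - (logVec (su2Quat (V b₀)) - logVec (su2Quat (V' b₀)))) := by
      rw [hd₁, hd₀]; abel
    rw [e3, norm_neg]
    exact h
  have hp₁ : ‖a₁‖ * ‖d₁‖ ≤ ((P.L : ℝ)⁻¹ * σ) * ((P.L : ℝ)⁻¹ * r) := mul_le_mul hA₁ hD₁ (norm_nonneg _) ((norm_nonneg _).trans hA₁)
  have hp₀ : ‖a₀‖ * ‖d₀‖ ≤ ((P.L : ℝ)⁻¹ * σ) * ((P.L : ℝ)⁻¹ * r) := mul_le_mul hA₀ hD₀ (norm_nonneg _) ((norm_nonneg _).trans hA₀)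
  linarith [key, hmain, hp₁, hp₀]

/-- ★★ **THE PAIR LETTER, COLUMN-LOCAL EDITION** (for per-block `max_{read}` profiles): as above, with the coarse relative variation bounded only on the hat COLUMN
through `(z; κ, ι)` (the support condition of ✓p829498 `norm_logVec_lift_rel_sub_shift_le_of_support` VERBATIM). [cite: Balaban1985RegularSpaces, (1.29) p.81] -/
theorem dist1_liftRelChord_shift_mul_inv_le_of_support (ht : t + 1 ≤ P.m + P.K) (w : PBond P t → PBond P (t + 1) → ℝ)
    (hw : ∀ b e, w b e = if e.dir = b.dir ∧ (b.src b.dir - emb e.src b.dir).val < P.L then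
      ∏ ν ∈ Finset.univ.erase b.dir, max 0 (1 - ((rel (emb e.src) b.src ν).natAbs : ℝ) / P.L) else 0)
    (X X' : GaugeField P (t + 1) SU2) (V V' : GaugeField P t SU2)
    (hV : ∀ b, V b = expPoint (∑ e, w b e • ((P.L : ℝ)⁻¹ • logVec (su2Quat (X e)))))
    (hV' : ∀ b, V' b = expPoint (∑ e, w b e • ((P.L : ℝ)⁻¹ • logVec (su2Quat (X' e)))))
    (z : Site P t) {ι κ : Fin P.d} (hικ : ι ≠ κ) {σ r v : ℝ} (hσ1 : σ ≤ 1) (hr1 : r ≤ 1)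
    (hσ : ∀ e, (w ⟨z, κ⟩ e ≠ 0 ∨ w ⟨z.shift ι, κ⟩ e ≠ 0) → ‖logVec (su2Quat (X e))‖ ≤ σ)
    (hr : ∀ e, (w ⟨z, κ⟩ e ≠ 0 ∨ w ⟨z.shift ι, κ⟩ e ≠ 0) → ‖logVec (su2Quat (X e)) - logVec (su2Quat (X' e))‖ ≤ r)
    (hv : ∀ y : Site P (t + 1), (if (z κ - emb y κ).val < P.L then (1 : ℝ) else 0) *
          (∏ ν ∈ (Finset.univ.erase κ).erase ι, max 0 (1 - ((rel (emb y) z ν).natAbs : ℝ) / P.L)) *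
          (if (z ι - emb y ι).val < P.L then (1 : ℝ) else 0) ≠ 0 →
      ‖(logVec (su2Quat (X ⟨y, κ⟩)) - logVec (su2Quat (X' ⟨y, κ⟩)))
        - (logVec (su2Quat (X ⟨y.shift ι, κ⟩)) - logVec (su2Quat (X' ⟨y.shift ι, κ⟩)))‖ ≤ v) :
    dist1 (((V ⟨z.shift ι, κ⟩)⁻¹ * V' ⟨z.shift ι, κ⟩) * ((V ⟨z, κ⟩)⁻¹ * V' ⟨z, κ⟩)⁻¹) ≤
      ((P.L : ℝ)⁻¹) ^ 2 * v + 16 * (((P.L : ℝ)⁻¹ * σ) * ((P.L : ℝ)⁻¹ * r)) := by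
  have hL0 : 0 ≤ (P.L : ℝ)⁻¹ := inv_nonneg.mpr (Nat.cast_nonneg _)
  have hL1 : (P.L : ℝ)⁻¹ ≤ 1 := by
    have hL : (1 : ℝ) ≤ (P.L : ℝ) := by exact_mod_cast P.hL.2.le
    exact inv_le_one_of_one_le₀ hL
  -- the logs of the lifts: `a_i := log V b_i`, `a_i + d_i := log V′ b_i`
  set b₀ : PBond P t := ⟨z, κ⟩ with hb₀
  set b₁ : PBond P t := ⟨z.shift ι, κ⟩ with hb₁
  set a₀ := logVec (su2Quat (V b₀)) with ha₀
  set a₁ := logVec (su2Quat (V b₁)) with ha₁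
  set d₀ := logVec (su2Quat (V' b₀)) - logVec (su2Quat (V b₀)) with hd₀
  set d₁ := logVec (su2Quat (V' b₁)) - logVec (su2Quat (V b₁)) with hd₁
  -- sizes: arcs of the lifts `≤ L⁻¹σ`, log-differences `≤ L⁻¹r`
  have hσ0 : ∀ e, w b₀ e ≠ 0 → ‖logVec (su2Quat (X e))‖ ≤ σ := fun e he => hσ e (Or.inl he)
  have hσ1' : ∀ e, w b₁ e ≠ 0 → ‖logVec (su2Quat (X e))‖ ≤ σ := fun e he => hσ e (Or.inr he)
  have hr0 : ∀ e, w b₀ e ≠ 0 → ‖logVec (su2Quat (X e)) - logVec (su2Quat (X' e))‖ ≤ r := fun e he => hr e (Or.inl he)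
  have hr1' : ∀ e, w b₁ e ≠ 0 → ‖logVec (su2Quat (X e)) - logVec (su2Quat (X' e))‖ ≤ r := fun e he => hr e (Or.inr he)
  have hA₀ : ‖a₀‖ ≤ (P.L : ℝ)⁻¹ * σ := arc_lift_le ht w hw X V hV b₀ hσ0
  have hA₁ : ‖a₁‖ ≤ (P.L : ℝ)⁻¹ * σ := arc_lift_le ht w hw X V hV b₁ hσ1'
  have hD₀ : ‖d₀‖ ≤ (P.L : ℝ)⁻¹ * r := by
    rw [hd₀, norm_sub_rev]; exact norm_logVec_lift_sub_le ht w hw X X' V V' hV hV' b₀ hr0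
  have hD₁ : ‖d₁‖ ≤ (P.L : ℝ)⁻¹ * r := by
    rw [hd₁, norm_sub_rev]; exact norm_logVec_lift_sub_le ht w hw X X' V V' hV hV' b₁ hr1'
  -- signs and unit bounds
  have hLpos : 0 < (P.L : ℝ)⁻¹ := by
    have h2 : (0 : ℝ) < (P.L : ℝ) := by exact_mod_cast lt_trans zero_lt_one P.hL.2
    exact inv_pos.mpr h2
  have hσ0' : 0 ≤ σ := (mul_nonneg_iff_of_pos_left hLpos).mp ((norm_nonneg _).trans hA₀)
  have hr0'' : 0 ≤ r := (mul_nonneg_iff_of_pos_left hLpos).mp ((norm_nonneg _).trans hD₀)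
  have hLσ1 : (P.L : ℝ)⁻¹ * σ ≤ 1 := (mul_le_of_le_one_left hσ0' hL1).trans hσ1
  have hLr1 : (P.L : ℝ)⁻¹ * r ≤ 1 := (mul_le_of_le_one_left hr0'' hL1).trans hr1
  -- the four bond values through their logs
  have eV₀ : V b₀ = expPoint a₀ := (expPoint_logVec (V b₀)).symm
  have eV₁ : V b₁ = expPoint a₁ := (expPoint_logVec (V b₁)).symm
  have eV₀' : V' b₀ = expPoint (a₀ + d₀) := by
    rw [ha₀, hd₀, add_sub_cancel]; exact (expPoint_logVec (V' b₀)).symm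
  have eV₁' : V' b₁ = expPoint (a₁ + d₁) := by
    rw [ha₁, hd₁, add_sub_cancel]; exact (expPoint_logVec (V' b₁)).symm
  have key := dist1_relChord_pair_le a₀ d₀ a₁ d₁ (hA₀.trans hLσ1) (hD₀.trans hLr1) (hA₁.trans hLσ1) (hD₁.trans hLr1)
  rw [← eV₀, ← eV₁, ← eV₀', ← eV₁'] at key
  -- the main term: the lift's exact `L⁻²` contraction of the log-difference field
  have hmain : ‖d₁ - d₀‖ ≤ ((P.L : ℝ)⁻¹) ^ 2 * v := by
    have h := norm_logVec_lift_rel_sub_shift_le_of_support ht w hw X X' V V' hV hV' z hικ hv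
    have e3 : d₁ - d₀ = -((logVec (su2Quat (V b₁)) - logVec (su2Quat (V' b₁))) - (logVec (su2Quat (V b₀)) - logVec (su2Quat (V' b₀)))) := by
      rw [hd₁, hd₀]; abel
    rw [e3, norm_neg]
    exact h
  have hp₁ : ‖a₁‖ * ‖d₁‖ ≤ ((P.L : ℝ)⁻¹ * σ) * ((P.L : ℝ)⁻¹ * r) := mul_le_mul hA₁ hD₁ (norm_nonneg _) ((norm_nonneg _).trans hA₁)
  have hp₀ : ‖a₀‖ * ‖d₀‖ ≤ ((P.L : ℝ)⁻¹ * σ) * ((P.L : ℝ)⁻¹ * r) := mul_le_mul hA₀ hD₀ (norm_nonneg _) ((norm_nonneg _).trans hA₀)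
  linarith [key, hmain, hp₁, hp₀]

end Lift

end Summit.QuantumFields.YangMills.Theorems.FluctuationComparisonRegPrIntLS2BetaRelativeLiftPairChord
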